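import Mathlib
import Literature.RingTheory.TwoVariableSeries.Basic
import Literature.AlgebraicGeometry.Resolution.FormalCoordinateChange
import Literature.AlgebraicGeometry.Resolution.CobordantGame
import Summits.ResolutionOfSingularities.ResolutionOfSingularities.Theorems.WeightedInvariantLocalWeightedDropTschirnhausFormAux
import Summits.ResolutionOfSingularities.ResolutionOfSingularities.Theorems.WeightedInvariantLocalWeightedDropMonicDescentStrategy

/-!
# `WeightedInvariant.LocalWeightedDrop`, sub-stub N4″: a SINGULAR slice represented by a label has no Newton point of degree ≤ 1 (piece T-6′, part D1)

Crux item stmt-ResolutionOfSingularities-8899 `LocalWeightedDrop` (route `ResolutionOfSingularities/WeightedInvariant`), door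
`WeightedConstruction` stmt-ResolutionOfSingularities-0571.  [OURS · L1 W4.3, chain w43, lead prover; part D1 of piece T-6′ (`monicDescentBridge`) of
`N4PRIME-PLAN.md` §11.]

* `two_le_order_of_isSingular` — a singular germ lies in `𝔪²`;
* `two_le_order_pos_of_represents` — if a singular `S` is represented by `(L₀, L₁)` then `pos L₀ L₁ ∈ 𝔪²` (formal coordinate changes preserve `𝔪²`,
  units preserve the order);
* `two_le_sum_of_represents_singular` — hence the scaled Newton set of `(L₀, L₁)` has no point of degree `≤ 1` (the second alternative of
  `dichotomy_of_wellPrepared` is excluded for singular slices).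
-/

set_option linter.dupNamespace false -- mandated namespace of this single-conjunct summit

noncomputable section

namespace Summit.ResolutionOfSingularities.ResolutionOfSingularities.Theorems

namespace MonicDescent

open MvPowerSeries Literature.RingTheory.TwoVariableSeries Literature.AlgebraicGeometry.Resolution

variable {k : Type} [Field k]

/-- A singular germ lies in `𝔪²`. -/
theorem two_le_order_of_isSingular {S : MvPowerSeries (Fin 3) k} (h : CobordantGame.IsSingular k S) : (2 : ℕ∞) ≤ S.order := by
  obtain ⟨-, h0, h1⟩ := h
  apply MvPowerSeries.le_order (n := ((2 : ℕ) : ℕ∞))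
  intro d hd
  have hd' : Finsupp.degree d < 2 := by exact_mod_cast hd
  by_cases hzero : d = 0
  · rw [hzero, coeff_zero_eq_constantCoeff_apply]; exact h0
  · -- `d` has degree 1: a single variable
    have hdeg1 : Finsupp.degree d = 1 := by
      have hne : Finsupp.degree d ≠ 0 := fun h => hzero ((Finsupp.degree_eq_zero_iff d).mp h)
      omega
    obtain ⟨i, hi⟩ : ∃ i, d = Finsupp.single i 1 := by
      have hsupp : d.support.Nonempty := Finsupp.support_nonempty_iff.mpr hzero
      obtain ⟨i, hi⟩ := hsupp
      refine ⟨i, ?_⟩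
      have hdi : 0 < d i := Nat.pos_of_ne_zero (Finsupp.mem_support_iff.mp hi)
      have hsum : Finsupp.degree d = ∑ j, d j := Finsupp.degree_eq_sum d
      rw [hdeg1, Fin.sum_univ_three] at hsum
      ext j
      rw [Finsupp.single_apply]
      fin_cases i <;> fin_cases j <;> simp at hdi ⊢ <;> omega
    rw [hi]; exact h1 i

/-- If a SINGULAR `S` is represented by `(L₀, L₁)` then `pos L₀ L₁ ∈ 𝔪²`. -/
theorem two_le_order_pos_of_represents {S : MvPowerSeries (Fin 3) k} {L₀ L₁ : MvPowerSeries (Fin 2) k}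
    (hrep : Represents S L₀ L₁) (hS : CobordantGame.IsSingular k S) : (2 : ℕ∞) ≤ (pos L₀ L₁).order := by
  obtain ⟨θ, H, hθ0, -, hH, hSub⟩ := hrep
  have h2 : (2 : ℕ∞) ≤ (subst θ S).order := FormalCoordChange.two_le_order_subst θ hθ0 S (two_le_order_of_isSingular hS)
  rw [hSub] at h2
  have hinv : H⁻¹ * (H * pos L₀ L₁) = pos L₀ L₁ := by
    rw [← mul_assoc, MvPowerSeries.inv_mul_cancel H hH, one_mul]
  calc (2 : ℕ∞) ≤ (H * pos L₀ L₁).order := h2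
    _ ≤ H⁻¹.order + (H * pos L₀ L₁).order := le_add_self
    _ ≤ (H⁻¹ * (H * pos L₀ L₁)).order := MvPowerSeries.le_order_mul
    _ = (pos L₀ L₁).order := by rw [hinv]

/-- The coefficient of `pos L₀ L₁` at a base exponent is the coefficient of `L₀`. -/
theorem coeff_pos_emb (L₀ L₁ : MvPowerSeries (Fin 2) k) (P : Fin 2 →₀ ℕ) :
    coeff (Finsupp.embDomain (Fin.succAboveEmb (Fin.last 2)) P) (pos L₀ L₁) = coeff P L₀ := by
  unfold pos
  have hlast : (Finsupp.embDomain (Fin.succAboveEmb (Fin.last 2)) P) (Fin.last 2) = 0 := by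
    rw [Finsupp.embDomain_notin_range]
    rintro ⟨i, hi⟩
    exact Fin.succAbove_ne (Fin.last 2) i hi
  rw [map_add, map_add, X_pow_eq, coeff_monomial, if_neg, zero_add, coeff_embDomain_rename,
    show (X (Fin.last 2) : MvPowerSeries (Fin 3) k) = monomial (Finsupp.single (Fin.last 2) 1) 1 from X_def _, coeff_mul_monomial,
    if_neg, add_zero]
  · intro hle
    have := hle (Fin.last 2)
    rw [hlast] at this
    simp at this
  · intro heq
    have := congrArg (fun f => f (Fin.last 2)) heq
    rw [hlast] at this
    simp at this

/-- The coefficient of `pos L₀ L₁` at `z` is the constant term of `L₁`. -/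
theorem coeff_pos_z (L₀ L₁ : MvPowerSeries (Fin 2) k) :
    coeff (Finsupp.single (Fin.last 2) 1) (pos L₀ L₁) = constantCoeff L₁ := by
  unfold pos
  have h0 := TschirnhausForm.coeff_emb_add_single_rename (m := 2) (k := k) (0 : Fin 2 →₀ ℕ) 1 L₀
  rw [Finsupp.embDomain_zero, zero_add, if_neg one_ne_zero] at h0
  rw [map_add, map_add, X_pow_eq, coeff_monomial, if_neg, zero_add, h0, zero_add,
    show (X (Fin.last 2) : MvPowerSeries (Fin 3) k) = monomial (Finsupp.single (Fin.last 2) 1) 1 from X_def _, coeff_mul_monomial,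
    if_pos le_rfl, mul_one, tsub_self, coeff_zero_eq_constantCoeff_apply, constantCoeff_rename]
  intro heq
  have := congrArg (fun f => f (Fin.last 2)) heq
  simp at this

/-- NO LOW POINT: if a singular `S` is represented by `(L₀, L₁)`, every point of the scaled Newton set of `(L₀, L₁)` has degree `≥ 2`. -/
theorem two_le_sum_of_represents_singular {S : MvPowerSeries (Fin 3) k} {L₀ L₁ : MvPowerSeries (Fin 2) k}
    (hrep : Represents S L₀ L₁) (hS : CobordantGame.IsSingular k S) :
    ∀ P ∈ newtonSet L₀ L₁, 2 ≤ P 0 + P 1 := by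
  have h2 := two_le_order_pos_of_represents hrep hS
  intro P hP
  by_contra hlt
  push Not at hlt
  rcases hP with hP | ⟨a, rfl, ha⟩
  · -- an `L₀`-exponent of degree ≤ 1
    have hc : coeff (Finsupp.embDomain (Fin.succAboveEmb (Fin.last 2)) P) (pos L₀ L₁) ≠ 0 := by
      rw [coeff_pos_emb]; exact hP
    have hle := MvPowerSeries.order_le hc
    have hdeg : Finsupp.degree (Finsupp.embDomain (Fin.succAboveEmb (Fin.last 2)) P) = P 0 + P 1 := by
      rw [Finsupp.degree_eq_sum, Fin.sum_univ_three]
      have e0 : (Finsupp.embDomain (Fin.succAboveEmb (Fin.last 2)) P) 0 = P 0 :=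
        Finsupp.embDomain_apply_self (Fin.succAboveEmb (Fin.last 2)) P 0
      have e1 : (Finsupp.embDomain (Fin.succAboveEmb (Fin.last 2)) P) 1 = P 1 :=
        Finsupp.embDomain_apply_self (Fin.succAboveEmb (Fin.last 2)) P 1
      have e2 : (Finsupp.embDomain (Fin.succAboveEmb (Fin.last 2)) P) 2 = 0 := by
        rw [Finsupp.embDomain_notin_range]
        rintro ⟨i, hi⟩
        exact Fin.succAbove_ne (Fin.last 2) i hi
      rw [e0, e1, e2, add_zero]
    rw [hdeg] at hle
    have : (2 : ℕ∞) ≤ ((P 0 + P 1 : ℕ) : ℕ∞) := le_trans h2 hle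
    have := ENat.coe_le_coe.mp (by exact_mod_cast this : ((2 : ℕ) : ℕ∞) ≤ ((P 0 + P 1 : ℕ) : ℕ∞))
    omega
  · -- an `L₁`-exponent `a` with `2|a| ≤ 1`: `a = 0`, constant term of `L₁`
    simp only [Finsupp.smul_apply, smul_eq_mul] at hlt
    have ha0 : a = 0 := by
      refine finsupp_fin2_ext ?_ ?_ <;> simp <;> omega
    rw [ha0, coeff_zero_eq_constantCoeff_apply] at ha
    have hc : coeff (Finsupp.single (Fin.last 2) 1) (pos L₀ L₁) ≠ 0 := by rw [coeff_pos_z]; exact ha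
    have hle := MvPowerSeries.order_le hc
    rw [Finsupp.degree_single] at hle
    have : (2 : ℕ∞) ≤ ((1 : ℕ) : ℕ∞) := le_trans h2 hle
    exact absurd (ENat.coe_le_coe.mp (by exact_mod_cast this : ((2 : ℕ) : ℕ∞) ≤ ((1 : ℕ) : ℕ∞))) (by norm_num)

end MonicDescent

end Summit.ResolutionOfSingularities.ResolutionOfSingularities.Theorems

end
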